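/-
Copyright (c) 2026 the pub-hodgecm-mathlib formalisation cell (harness21).  Prover seat hodgecm-mathlib-K2E2-p12 (g3): Track B «K2-LIT»,
#184♮ = hLiu418 = stmt-HodgeConjecture-24832; organ #33b (c) «RESTRICTED PRODUCT OF LOCAL SIEGEL SECTIONS» of the tier-1 socket module
`Cruxes/HLiu418/Lines/K2_Liu_CurveThetaSigs_U5d_ZetaS.lean` (#33b `hBC`, consumer K2E5-p16 (g3); LEAD F0P6-plan (g11) deal 2026-09-04T05:05:57Z,
GO (c1) 05:07:31Z); 2026-09-04.
-/
import Summits.HodgeConjecture.HodgeConjecture.Theorems.K2LiuStdFamilyFactorisablePrelims        -- ★ #31s kit: `archPart_mul'`, `placesEmbed` components, `exists_siegelDelta_prod`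
import Summits.HodgeConjecture.HodgeConjecture.Theorems.K2LiuDoublingHeightQuasiFactorization    -- ★ `isSiegelDelta_locToAdelic_evalPlace`
import Summits.HodgeConjecture.HodgeConjecture.Theorems.K2LiuIwasawaDatumAdapted                  -- ★ `isSiegelDelta_finAdelicToAdelic_of_forall_mem_siegelDeltaLoc`
import HarnessLib

/-!
# Crux `HLiu418`, Track B road `K2_Liu`, unit U5d «`Z_S`», organ #33b (c):
# the restricted product of local Siegel sections is a global Siegel section

Cell `hodgecm-mathlib`, crux item hLiu418 = `stmt-HodgeConjecture-24832`, route of record `HCCMUnconditional`; squad K2 ∕ K2Liu.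

★ #31s `K2LiuStdFamilyFactorisable.stdFamilyFactorisable` READ FORWARDS.  Given a function `fS` on `H_∞ × ∏_{v∈S} H(L⁺_v)` which is a
`δ_{χ,s₀} ∘ placesEmbed`-section there (`hfS`), the function on `H(𝔸)`
`φ(h) := fS(h_∞, (h_v)_{v∈S}) · ∏ᶠ_{v∉S} Λ_{s₀,v}(h_v)`
(`Λ_{s₀,v}` = ★ `LambdaLoc`, the `K_{H,v}`-spherical local Siegel section) satisfies
* `restrictedProduct_comp_placesEmbed` — `φ(placesEmbed(x)) = fS(x)`;
* `restrictedProduct_mul_of_mem_KS` — right-`K^S_H`-invariance `φ(h k) = φ(h)` (`k_∞ = 1`, all `k_v ∈ K_{H,v}`, `k_v = 1` on `S`);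
* `isSiegelDeltaSection_restrictedProduct` — **`φ ∈ I(s₀, χ)` is a Siegel section**: `φ(p h) = δ_{χ,s₀}(p) φ(h)` for `p ∈ P_Δ(𝔸)`.
The heart is the PLACE FACTORISATION of the Siegel character (`siegelDeltaCharacter_eq_placesEmbed_mul_finprod`):
`δ_{χ,s₀}(p) = δ_{χ,s₀}(placesEmbed(p_∞, p_S)) · ∏ᶠ_{v∉S} χ_{s₀,v}(p_v)`, proved from ★ `exists_siegelDelta_prod` (the finitely many
non-integral components) and the hypothesis `hδK` «`δ_{χ,s₀}` is trivial on `P_Δ(𝔸) ∩ K^S_H`» — taken BY VALUE exactly like #31s's `_hR`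
(its discharge from `hχ` is organ (c0): ★ `IdelicCharacter.map_eq_one_of_forall_valued_eq_one` + ★ `modDelta_eq_one_of_mem_compact_subgroup`).
Local inputs: ★ `lambdaLoc_siegel_mul` (local section law), ★ `lambdaLoc_mul_localInt`, ★ `lambdaLoc_of_mem_localInt`, ★ `lambdaLoc_one`,
★ `siegelCharLoc_eq_one_of_mem_localInt`; `p_v ∈ P_Δ(L⁺_v)` for `p ∈ P_Δ(𝔸)` is ★ `isSiegelDelta_locToAdelic_evalPlace`.
[cite: Tan1999, §1] [cite: Liu2011, §2B–2C pp. 862–863] [cite: GelbartPiatetskishapiroRallis1987, Part A §1] [cite: KudlaRallis1994, §1] [cite: BorelJacquet1979, §4.1]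

HONEST LABEL: HC_CM is proved only modulo the 7 printed citations (2 remaining named inputs: hLiu418 = stmt-HodgeConjecture-24832,
h413 = stmt-HodgeConjecture-24833) until rung 0 closes; this file is a helper (`--supports stmt-HodgeConjecture-24832`) and closes no socket by itself.
-/

set_option linter.dupNamespace false

noncomputable section

open scoped RestrictedProduct
open Filter NumberField IsDedekindDomain

namespace Summit.HodgeConjecture.HodgeConjecture.Cruxes.HLiu418.K2LiuSiegelSectionRestrictedProduct

open Literature.NumberTheory.K2Lit.PlaceSplitting
open Literature.NumberTheory.Automorphic Literature.NumberTheory.Automorphic.UnitaryGroup Literature.NumberTheory.GaloisRepresentations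
open Literature.NumberTheory.GelbartRogawski1991 Literature.NumberTheory.GelbartRogawski1991.GRConstruction
open Literature.NumberTheory.K2Lit.SiegelDoubled
open Summit.HodgeConjecture.HodgeConjecture.Cruxes.HLiu418.K2LiuStdFamilyFactorisable
open Summit.HodgeConjecture.HodgeConjecture.Cruxes.HLiu418.K2LiuDoublingHeightQuasiFactorization (isSiegelDelta_locToAdelic_evalPlace)
open Summit.HodgeConjecture.HodgeConjecture.Cruxes.HLiu418.K2LiuIwasawaDatumAdapted (isSiegelDelta_finAdelicToAdelic_of_forall_mem_siegelDeltaLoc)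

variable (L : Type) [Field L] [NumberField L] [IsCMField L]
variable {N M n : ℕ} (e : Fin N × Fin M ≃ Fin n)
  (dV : Fin N → L) (hdV : ∀ i, IsCMField.complexConj L (dV i) = dV i)
  (dW : Fin M → L) (hdW : ∀ i, IsCMField.complexConj L (dW i) = dW i)
  (S : Finset (HeightOneSpectrum (𝓞 (Fp L)))) [DecidableEq (HeightOneSpectrum (𝓞 (Fp L)))]
  (χ : HeckeCharacter L) (s₀ : ℂ)

/-! ## §1 Components of a Siegel element -/

omit [DecidableEq (HeightOneSpectrum (𝓞 (Fp L)))] in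
/-- **`p_v ∈ P_Δ(L⁺_v)` for `p ∈ P_Δ(𝔸)`** (★ `isSiegelDelta_locToAdelic_evalPlace` in the `siegelDeltaLoc` spelling). [cite: Tan1999, §1] -/
theorem evalPlace_finPart_mem_siegelDeltaLoc (p : HA L e dV hdV dW hdW) (hp : IsSiegelDelta L e dV hdV dW hdW p) (v : HeightOneSpectrum (𝓞 (Fp L))) :
    evalPlace (Fp L) L (IsCMField.complexConj L) (n + n) (hermD L e dV hdV dW hdW) v (finPart (Fp L) L (IsCMField.complexConj L) (n + n)
        (hermD L e dV hdV dW hdW) p) ∈ siegelDeltaLoc L e dV hdV dW hdW v :=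
  (mem_siegelDeltaLoc_iff L e dV hdV dW hdW v _).2 (isSiegelDelta_locToAdelic_evalPlace L e dV hdV dW hdW v p hp)

omit [DecidableEq (HeightOneSpectrum (𝓞 (Fp L)))] in
/-- the places `v ∉ S` where `x_v ∉ K_{H,v}` are finitely many (restricted product). [cite: BorelJacquet1979, §4.1] -/
theorem finite_setOf_evalPlace_finPart_not_mem_localInt (x : HA L e dV hdV dW hdW) :
    {v : {v : HeightOneSpectrum (𝓞 (Fp L)) // v ∉ S} | evalPlace (Fp L) L (IsCMField.complexConj L) (n + n) (hermD L e dV hdV dW hdW) v.1 (finPart (Fp L) L (IsCMField.complexConj L)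
        (n + n) (hermD L e dV hdV dW hdW) x) ∉ localInt L (IsCMField.complexConj L) (n + n) (hermD L e dV hdV dW hdW) v.1}.Finite :=
  (Filter.eventually_cofinite.1 (eventually_evalPlace_mem_localInt (Fp L) L (IsCMField.complexConj L) (n + n) (hermD L e dV hdV dW hdW) (finPart (Fp L) L (IsCMField.complexConj L) (n + n)
      (hermD L e dV hdV dW hdW) x))).preimage Subtype.val_injective.injOn

omit [DecidableEq (HeightOneSpectrum (𝓞 (Fp L)))] in
/-- a function of the place which is `1` wherever `x_v ∈ K_{H,v}` has finite multiplicative support. [cite: BorelJacquet1979, §4.1] -/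
theorem mulSupport_finite_of_eq_one_of_mem_localInt (x : HA L e dV hdV dW hdW) (g : {v : HeightOneSpectrum (𝓞 (Fp L)) // v ∉ S} → ℂ)
    (hg : ∀ v : {v : HeightOneSpectrum (𝓞 (Fp L)) // v ∉ S}, evalPlace (Fp L) L (IsCMField.complexConj L) (n + n) (hermD L e dV hdV dW hdW) v.1 (finPart (Fp L) L (IsCMField.complexConj L)
        (n + n) (hermD L e dV hdV dW hdW) x) ∈ localInt L (IsCMField.complexConj L) (n + n) (hermD L e dV hdV dW hdW) v.1 → g v = 1) : (Function.mulSupport g).Finite :=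
  (finite_setOf_evalPlace_finPart_not_mem_localInt L e dV hdV dW hdW S x).subset fun v hv hmem => (Function.mem_mulSupport.1 hv) (hg v hmem)

set_option maxHeartbeats 400000 in -- the doubled unitary datum's binder telescope (`HA` vs `adelicGroupData.Adelic` unfolding)
/-- **`placesEmbed(p_∞, p_S) ∈ P_Δ(𝔸)` for `p ∈ P_Δ(𝔸)`**: `placesEmbed(p_∞, p_S) = p · (1, p_f⁻¹ · placesEmbedFin(p_S))` and the second factor has
every place component in `P_Δ(L⁺_v)` (★ `isSiegelDelta_finAdelicToAdelic_of_forall_mem_siegelDeltaLoc`). [cite: Tan1999, §1] [cite: BorelJacquet1979, §4.1] -/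
theorem isSiegelDelta_placesEmbed (p : HA L e dV hdV dW hdW) (hp : IsSiegelDelta L e dV hdV dW hdW p) : IsSiegelDelta L e dV hdV dW hdW (placesEmbed L (hermD L e dV hdV dW hdW) S
    (archPart (Fp L) L (IsCMField.complexConj L) (n + n) (hermD L e dV hdV dW hdW) p, fun v : S => evalPlace (Fp L) L (IsCMField.complexConj L) (n + n) (hermD L e dV hdV dW hdW) v.1
    (finPart (Fp L) L (IsCMField.complexConj L) (n + n) (hermD L e dV hdV dW hdW) p))) := by
  have hpv := evalPlace_finPart_mem_siegelDeltaLoc L e dV hdV dW hdW p hp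
  obtain ⟨C, hCdef⟩ : ∃ C : HA L e dV hdV dW hdW, C = finAdelicToAdelic (Fp L) L (IsCMField.complexConj L) (n + n) (hermD L e dV hdV dW hdW)
      ((finPart (Fp L) L (IsCMField.complexConj L) (n + n) (hermD L e dV hdV dW hdW) p)⁻¹ * placesEmbedFin L (hermD L e dV hdV dW hdW) S (fun v : S => evalPlace (Fp L) L
          (IsCMField.complexConj L) (n + n) (hermD L e dV hdV dW hdW) v.1 (finPart (Fp L) L (IsCMField.complexConj L) (n + n) (hermD L e dV hdV dW hdW) p))) := ⟨_, rfl⟩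
  have hC : IsSiegelDelta L e dV hdV dW hdW C := by
    rw [hCdef]
    refine isSiegelDelta_finAdelicToAdelic_of_forall_mem_siegelDeltaLoc L e dV hdV dW hdW _ fun v => ?_
    rw [map_mul, map_inv]
    by_cases hv : v ∈ S
    · rw [evalPlace_placesEmbedFin_of_mem L e dV hdV dW hdW S _ v hv, inv_mul_cancel]
      exact (siegelDeltaLoc L e dV hdV dW hdW v).one_mem
    · rw [evalPlace_placesEmbedFin_of_not_mem L e dV hdV dW hdW S _ v hv, mul_one]
      exact (siegelDeltaLoc L e dV hdV dW hdW v).inv_mem (hpv v)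
  have heq : placesEmbed L (hermD L e dV hdV dW hdW) S (archPart (Fp L) L (IsCMField.complexConj L) (n + n) (hermD L e dV hdV dW hdW) p, fun v : S => evalPlace (Fp L) L
      (IsCMField.complexConj L) (n + n) (hermD L e dV hdV dW hdW) v.1 (finPart (Fp L) L (IsCMField.complexConj L) (n + n) (hermD L e dV hdV dW hdW) p)) = p * C := by
    refine eq_of_archPart_eq_of_finPart_eq L e dV hdV dW hdW _ _ ?_ ?_
    · rw [archPart_placesEmbed, archPart_mul', hCdef, archPart_finAdelicToAdelic, mul_one]
    · rw [finPart_placesEmbed, finPart_mul', hCdef, finPart_finAdelicToAdelic, mul_inv_cancel_left]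
  rw [heq]
  exact isSiegelDelta_mul L e dV hdV dW hdW hp hC

/-! ## §2 The local factors off `S` -/

omit [DecidableEq (HeightOneSpectrum (𝓞 (Fp L)))] in
/-- **right `K^S_H`-invariance of `∏ᶠ_{v∉S} Λ_{s₀,v}`** (★ `lambdaLoc_mul_localInt` place by place). [cite: Liu2011, §2C (2-4) p. 863] [cite: Tan1999, §1] -/
theorem finprod_lambdaLoc_mul_of_mem_localInt (hχ : ∀ v, v ∉ S → ∀ w' : PlacesOver L v, χ.IsUnramifiedAt w'.1) (h k : HA L e dV hdV dW hdW)
    (hk : ∀ v, evalPlace (Fp L) L (IsCMField.complexConj L) (n + n) (hermD L e dV hdV dW hdW) v (finPart (Fp L) L (IsCMField.complexConj L) (n + n)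
        (hermD L e dV hdV dW hdW) k) ∈ localInt L (IsCMField.complexConj L) (n + n) (hermD L e dV hdV dW hdW) v) :
    ∏ᶠ v : {v : HeightOneSpectrum (𝓞 (Fp L)) // v ∉ S}, LambdaLoc L e dV hdV dW hdW v.1 χ s₀ (evalPlace (Fp L) L (IsCMField.complexConj L) (n + n) (hermD L e dV hdV dW hdW) v.1 (finPart
        (Fp L) L (IsCMField.complexConj L) (n + n) (hermD L e dV hdV dW hdW) (h * k))) = ∏ᶠ v : {v : HeightOneSpectrum (𝓞 (Fp L)) // v ∉ S}, LambdaLoc L e dV hdV dW hdW v.1 χ s₀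
        (evalPlace (Fp L) L (IsCMField.complexConj L) (n + n) (hermD L e dV hdV dW hdW) v.1 (finPart (Fp L) L (IsCMField.complexConj L) (n + n) (hermD L e dV hdV dW hdW) h)) :=
  finprod_congr fun v => by rw [evalPlace_finPart_mul', lambdaLoc_mul_localInt L e dV hdV dW hdW v.1 χ s₀ (hχ v.1 v.2) _ (hk v.1)]

omit [DecidableEq (HeightOneSpectrum (𝓞 (Fp L)))] in
/-- **the local section law off `S`, multiplied over the places**: `∏ᶠ_{v∉S} Λ_{s₀,v}((p h)_v) = (∏ᶠ_{v∉S} χ_{s₀,v}(p_v)) · ∏ᶠ_{v∉S} Λ_{s₀,v}(h_v)` for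
`p ∈ P_Δ(𝔸)` (★ `lambdaLoc_siegel_mul`; both supports are finite: ★ `siegelCharLoc_eq_one_of_mem_localInt`, ★ `lambdaLoc_of_mem_localInt`).
[cite: Liu2011, §2C (2-4) p. 863] [cite: Tan1999, §1] -/
theorem finprod_lambdaLoc_siegel_mul (hχ : ∀ v, v ∉ S → ∀ w' : PlacesOver L v, χ.IsUnramifiedAt w'.1) (p h : HA L e dV hdV dW hdW) (hp : IsSiegelDelta L e dV hdV dW hdW p) :
    ∏ᶠ v : {v : HeightOneSpectrum (𝓞 (Fp L)) // v ∉ S}, LambdaLoc L e dV hdV dW hdW v.1 χ s₀ (evalPlace (Fp L) L (IsCMField.complexConj L) (n + n) (hermD L e dV hdV dW hdW) v.1 (finPart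
        (Fp L) L (IsCMField.complexConj L) (n + n) (hermD L e dV hdV dW hdW) (p * h))) =
      (∏ᶠ v : {v : HeightOneSpectrum (𝓞 (Fp L)) // v ∉ S}, siegelCharLoc L e dV hdV dW hdW v.1 χ s₀ (evalPlace (Fp L) L (IsCMField.complexConj L) (n + n) (hermD L e dV hdV dW hdW) v.1
          (finPart (Fp L) L (IsCMField.complexConj L) (n + n) (hermD L e dV hdV dW hdW) p))) * ∏ᶠ v : {v : HeightOneSpectrum (𝓞 (Fp L)) // v ∉ S}, LambdaLoc L e dV hdV dW hdW v.1 χ s₀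
          (evalPlace (Fp L) L (IsCMField.complexConj L) (n + n) (hermD L e dV hdV dW hdW) v.1 (finPart (Fp L) L (IsCMField.complexConj L) (n + n) (hermD L e dV hdV dW hdW) h)) := by
  have hpv := evalPlace_finPart_mem_siegelDeltaLoc L e dV hdV dW hdW p hp
  rw [← finprod_mul_distrib]
  · exact finprod_congr fun v => by rw [evalPlace_finPart_mul', lambdaLoc_siegel_mul L e dV hdV dW hdW v.1 χ s₀ (hχ v.1 v.2) (hpv v.1)]
  · exact mulSupport_finite_of_eq_one_of_mem_localInt L e dV hdV dW hdW S p _ fun v hmem =>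
      siegelCharLoc_eq_one_of_mem_localInt L e dV hdV dW hdW v.1 χ s₀ (hχ v.1 v.2) (hpv v.1) hmem
  · exact mulSupport_finite_of_eq_one_of_mem_localInt L e dV hdV dW hdW S h _ fun v hmem =>
      lambdaLoc_of_mem_localInt L e dV hdV dW hdW v.1 χ s₀ (hχ v.1 v.2) hmem

/-! ## §3 Place factorisation of the Siegel character -/

set_option maxHeartbeats 800000 in -- the doubled unitary datum's binder telescope + adelic component bookkeeping (as ★ #31s); plain `rw`∕`exact`
/-- **`δ_{χ,s₀}(p) = δ_{χ,s₀}(placesEmbed(p_∞, p_S)) · ∏ᶠ_{v∉S} χ_{s₀,v}(p_v)`** for `p ∈ P_Δ(𝔸)`, GIVEN that `δ_{χ,s₀}` is trivial on `P_Δ(𝔸) ∩ K^S_H`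
(`hδK`, by value).  Proof: with `T` the finite set of `v ∉ S` where `p_v ∉ K_{H,v}` and `P = ∏_{v∈T} ι_v(p_v)` (★ `exists_siegelDelta_prod`),
`r := P⁻¹ · placesEmbed(p_∞,p_S)⁻¹ · p` lies in `P_Δ(𝔸) ∩ K^S_H`, so `δ(p) = δ(placesEmbed(p_∞,p_S)) · δ(P) · δ(r)` with `δ(r) = 1` and
`δ(P) = ∏_{v∈T} χ_{s₀,v}(p_v) = ∏ᶠ_{v∉S} χ_{s₀,v}(p_v)`. [cite: Tan1999, §1] [cite: KudlaRallis1994, §1] [cite: BorelJacquet1979, §4.1] -/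
theorem siegelDeltaCharacter_eq_placesEmbed_mul_finprod (hχ : ∀ v, v ∉ S → ∀ w' : PlacesOver L v, χ.IsUnramifiedAt w'.1)
    (hδK : ∀ q : HA L e dV hdV dW hdW, IsSiegelDelta L e dV hdV dW hdW q → archPart (Fp L) L (IsCMField.complexConj L) (n + n) (hermD L e dV hdV dW hdW) q = 1 → (∀ v, evalPlace (Fp L) L
        (IsCMField.complexConj L) (n + n) (hermD L e dV hdV dW hdW) v (finPart (Fp L) L (IsCMField.complexConj L) (n + n) (hermD L e dV hdV dW hdW) q) ∈ localInt L
        (IsCMField.complexConj L) (n + n) (hermD L e dV hdV dW hdW) v) →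
      (∀ v ∈ S, evalPlace (Fp L) L (IsCMField.complexConj L) (n + n) (hermD L e dV hdV dW hdW) v (finPart (Fp L) L (IsCMField.complexConj L) (n + n)
          (hermD L e dV hdV dW hdW) q) = 1) → siegelDeltaCharacter L e dV hdV dW hdW χ s₀ q = 1)
    (p : HA L e dV hdV dW hdW) (hp : IsSiegelDelta L e dV hdV dW hdW p) :
    siegelDeltaCharacter L e dV hdV dW hdW χ s₀ p = siegelDeltaCharacter L e dV hdV dW hdW χ s₀ (placesEmbed L (hermD L e dV hdV dW hdW) S (archPart (Fp L) L (IsCMField.complexConj L)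
        (n + n) (hermD L e dV hdV dW hdW) p, fun v : S => evalPlace (Fp L) L (IsCMField.complexConj L) (n + n) (hermD L e dV hdV dW hdW) v.1 (finPart (Fp L) L (IsCMField.complexConj L)
        (n + n) (hermD L e dV hdV dW hdW) p))) * ∏ᶠ v : {v : HeightOneSpectrum (𝓞 (Fp L)) // v ∉ S}, siegelCharLoc L e dV hdV dW hdW v.1 χ s₀ (evalPlace (Fp L) L (IsCMField.complexConj L)
        (n + n) (hermD L e dV hdV dW hdW) v.1 (finPart (Fp L) L (IsCMField.complexConj L) (n + n) (hermD L e dV hdV dW hdW) p)) := by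
  classical
  have hpv := evalPlace_finPart_mem_siegelDeltaLoc L e dV hdV dW hdW p hp
  have hpEΔ := isSiegelDelta_placesEmbed L e dV hdV dW hdW S p hp
  obtain ⟨pE, hpEdef⟩ : ∃ pE : HA L e dV hdV dW hdW, pE = placesEmbed L (hermD L e dV hdV dW hdW) S (archPart (Fp L) L (IsCMField.complexConj L) (n + n)
      (hermD L e dV hdV dW hdW) p, fun v : S => evalPlace (Fp L) L (IsCMField.complexConj L) (n + n) (hermD L e dV hdV dW hdW) v.1 (finPart (Fp L) L (IsCMField.complexConj L) (n + n)
      (hermD L e dV hdV dW hdW) p)) := ⟨_, rfl⟩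
  rw [← hpEdef] at hpEΔ ⊢
  have hpE_arch : archPart (Fp L) L (IsCMField.complexConj L) (n + n) (hermD L e dV hdV dW hdW) pE = archPart (Fp L) L (IsCMField.complexConj L) (n + n) (hermD L e dV hdV dW hdW) p := by
    rw [hpEdef]; exact archPart_placesEmbed L e dV hdV dW hdW S _ _
  have hpE_S : ∀ v ∈ S, evalPlace (Fp L) L (IsCMField.complexConj L) (n + n) (hermD L e dV hdV dW hdW) v (finPart (Fp L) L (IsCMField.complexConj L) (n + n)
      (hermD L e dV hdV dW hdW) pE) = evalPlace (Fp L) L (IsCMField.complexConj L) (n + n) (hermD L e dV hdV dW hdW) v (finPart (Fp L) L (IsCMField.complexConj L) (n + n)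
      (hermD L e dV hdV dW hdW) p) := by
    intro v hv; rw [hpEdef]; exact evalPlace_finPart_placesEmbed_of_mem L e dV hdV dW hdW S _ _ v hv
  have hpE_off : ∀ v, v ∉ S → evalPlace (Fp L) L (IsCMField.complexConj L) (n + n) (hermD L e dV hdV dW hdW) v (finPart (Fp L) L (IsCMField.complexConj L) (n + n)
      (hermD L e dV hdV dW hdW) pE) = 1 := by
    intro v hv; rw [hpEdef]; exact evalPlace_finPart_placesEmbed_of_not_mem L e dV hdV dW hdW S _ _ v hv
  /- the exceptional finite set `T` and `P = ∏_{v∈T} ι_v(p_v)` -/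
  have hfin := finite_setOf_evalPlace_finPart_not_mem_localInt L e dV hdV dW hdW S p
  set T := hfin.toFinset with hTdef
  have hT : ∀ v : {v : HeightOneSpectrum (𝓞 (Fp L)) // v ∉ S}, v ∈ T ↔ evalPlace (Fp L) L (IsCMField.complexConj L) (n + n) (hermD L e dV hdV dW hdW) v.1 (finPart (Fp L) L
      (IsCMField.complexConj L) (n + n) (hermD L e dV hdV dW hdW) p) ∉ localInt L (IsCMField.complexConj L) (n + n) (hermD L e dV hdV dW hdW) v.1 := fun v => by
    rw [hTdef, Set.Finite.mem_toFinset]; rfl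
  obtain ⟨P, hPΔ, hPa, hPT, hPoff, hPχ⟩ := exists_siegelDelta_prod L e dV hdV dW hdW S χ s₀ (fun v : {v : HeightOneSpectrum (𝓞 (Fp L)) // v ∉ S} => evalPlace (Fp L) L
      (IsCMField.complexConj L) (n + n) (hermD L e dV hdV dW hdW) v.1 (finPart (Fp L) L (IsCMField.complexConj L) (n + n) (hermD L e dV hdV dW hdW) p)) (fun v => hpv v.1) T
  /- `r := P⁻¹ (pE⁻¹ p) ∈ P_Δ(𝔸) ∩ K^S_H` -/
  obtain ⟨r, hrdef⟩ : ∃ r : HA L e dV hdV dW hdW, r = P⁻¹ * (pE⁻¹ * p) := ⟨_, rfl⟩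
  have hrΔ : IsSiegelDelta L e dV hdV dW hdW r := by
    rw [hrdef]
    exact isSiegelDelta_mul L e dV hdV dW hdW (isSiegelDelta_inv L e dV hdV dW hdW hPΔ)
      (isSiegelDelta_mul L e dV hdV dW hdW (isSiegelDelta_inv L e dV hdV dW hdW hpEΔ) hp)
  have hr1 : archPart (Fp L) L (IsCMField.complexConj L) (n + n) (hermD L e dV hdV dW hdW) r = 1 := by
    rw [hrdef]
    exact map_conj_eq_one (fun x : HA L e dV hdV dW hdW => archPart (Fp L) L (IsCMField.complexConj L) (n + n) (hermD L e dV hdV dW hdW) x) (archPart_mul' L e dV hdV dW hdW)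
        (archPart_inv' L e dV hdV dW hdW) hPa hpE_arch
  have hr3 : ∀ v ∈ S, evalPlace (Fp L) L (IsCMField.complexConj L) (n + n) (hermD L e dV hdV dW hdW) v (finPart (Fp L) L (IsCMField.complexConj L) (n + n)
      (hermD L e dV hdV dW hdW) r) = 1 := by
    intro v hv
    rw [hrdef]
    exact map_conj_eq_one (fun x : HA L e dV hdV dW hdW => evalPlace (Fp L) L (IsCMField.complexConj L) (n + n) (hermD L e dV hdV dW hdW) v (finPart (Fp L) L (IsCMField.complexConj L)
        (n + n) (hermD L e dV hdV dW hdW) x)) (evalPlace_finPart_mul' L e dV hdV dW hdW v) (evalPlace_finPart_inv' L e dV hdV dW hdW v)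
      (hPoff v fun ⟨hv', _⟩ => hv' hv) (hpE_S v hv)
  have hr2 : ∀ v, evalPlace (Fp L) L (IsCMField.complexConj L) (n + n) (hermD L e dV hdV dW hdW) v (finPart (Fp L) L (IsCMField.complexConj L) (n + n)
      (hermD L e dV hdV dW hdW) r) ∈ localInt L (IsCMField.complexConj L) (n + n) (hermD L e dV hdV dW hdW) v := by
    intro v
    by_cases hv : v ∈ S
    · rw [hr3 v hv]; exact one_mem _
    · by_cases hvT : (⟨v, hv⟩ : {v : HeightOneSpectrum (𝓞 (Fp L)) // v ∉ S}) ∈ T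
      · have h4 : evalPlace (Fp L) L (IsCMField.complexConj L) (n + n) (hermD L e dV hdV dW hdW) v (finPart (Fp L) L (IsCMField.complexConj L) (n + n) (hermD L e dV hdV dW hdW) r) = 1 := by
          rw [hrdef]
          exact map_conj_eq_of (fun x : HA L e dV hdV dW hdW => evalPlace (Fp L) L (IsCMField.complexConj L) (n + n) (hermD L e dV hdV dW hdW) v (finPart (Fp L) L
              (IsCMField.complexConj L) (n + n) (hermD L e dV hdV dW hdW) x)) (evalPlace_finPart_mul' L e dV hdV dW hdW v) (evalPlace_finPart_inv' L e dV hdV dW hdW v)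
            (hPT _ hvT) (hpE_off v hv) (mul_one _).symm
        rw [h4]; exact one_mem _
      · have h4 : evalPlace (Fp L) L (IsCMField.complexConj L) (n + n) (hermD L e dV hdV dW hdW) v (finPart (Fp L) L (IsCMField.complexConj L) (n + n)
          (hermD L e dV hdV dW hdW) r) = evalPlace (Fp L) L (IsCMField.complexConj L) (n + n) (hermD L e dV hdV dW hdW) v (finPart (Fp L) L (IsCMField.complexConj L) (n + n)
          (hermD L e dV hdV dW hdW) p) := by
          rw [hrdef]
          exact map_conj_eq_self (fun x : HA L e dV hdV dW hdW => evalPlace (Fp L) L (IsCMField.complexConj L) (n + n) (hermD L e dV hdV dW hdW) v (finPart (Fp L) L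
              (IsCMField.complexConj L) (n + n) (hermD L e dV hdV dW hdW) x)) (evalPlace_finPart_mul' L e dV hdV dW hdW v) (evalPlace_finPart_inv' L e dV hdV dW hdW v)
            (hPoff v fun ⟨hv', hm⟩ => hvT hm) (hpE_off v hv)
        rw [h4]; exact not_not.1 ((hT ⟨v, hv⟩).not.1 hvT)
  have hδr : siegelDeltaCharacter L e dV hdV dW hdW χ s₀ r = 1 := hδK r hrΔ hr1 hr2 hr3
  /- `p = pE · P · r` and the character -/
  have hfac : p = pE * (P * r) := by rw [hrdef, mul_inv_cancel_left, mul_inv_cancel_left]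
  conv_lhs => rw [hfac]
  rw [siegelDeltaCharacter_mul L e dV hdV dW hdW χ s₀ hpEΔ (isSiegelDelta_mul L e dV hdV dW hdW hPΔ hrΔ),
    siegelDeltaCharacter_mul L e dV hdV dW hdW χ s₀ hPΔ hrΔ, hδr, mul_one, hPχ]
  congr 1
  rw [finprod_eq_prod_of_mulSupport_subset _ (s := T) ?_]
  intro v hv
  rw [Function.mem_mulSupport] at hv
  rw [Finset.mem_coe, hT]
  exact fun hmem => hv (siegelCharLoc_eq_one_of_mem_localInt L e dV hdV dW hdW v.1 χ s₀ (hχ v.1 v.2) (hpv v.1) hmem)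

/-! ## §4 The restricted product `φ(h) = fS(h_∞, h_S) · ∏ᶠ_{v∉S} Λ_{s₀,v}(h_v)` -/

/-- **`φ ∘ placesEmbed = fS`**: on `placesEmbed(x)` every factor `Λ_{s₀,v}`, `v ∉ S`, sees the component `1` (★ `lambdaLoc_one`).
[cite: Liu2011, §2B p. 862] [cite: Tan1999, §1] -/
theorem restrictedProduct_comp_placesEmbed (hχ : ∀ v, v ∉ S → ∀ w' : PlacesOver L v, χ.IsUnramifiedAt w'.1) (fS : arch (Fp L) L (IsCMField.complexConj L) (n + n)
    (hermD L e dV hdV dW hdW) × (Π v : S, localPi L (IsCMField.complexConj L) (n + n) (hermD L e dV hdV dW hdW) v.1) → ℂ)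
    (x : arch (Fp L) L (IsCMField.complexConj L) (n + n) (hermD L e dV hdV dW hdW) × (Π v : S, localPi L (IsCMField.complexConj L) (n + n) (hermD L e dV hdV dW hdW) v.1)) :
    (fun h : HA L e dV hdV dW hdW => fS (archPart (Fp L) L (IsCMField.complexConj L) (n + n) (hermD L e dV hdV dW hdW) h, fun v : S => evalPlace (Fp L) L (IsCMField.complexConj L) (n + n)
        (hermD L e dV hdV dW hdW) v.1 (finPart (Fp L) L (IsCMField.complexConj L) (n + n) (hermD L e dV hdV dW hdW) h)) * ∏ᶠ v : {v : HeightOneSpectrum (𝓞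
        (Fp L)) // v ∉ S}, LambdaLoc L e dV hdV dW hdW v.1 χ s₀ (evalPlace (Fp L) L (IsCMField.complexConj L) (n + n) (hermD L e dV hdV dW hdW) v.1 (finPart (Fp L) L
        (IsCMField.complexConj L) (n + n) (hermD L e dV hdV dW hdW) h))) (placesEmbed L (hermD L e dV hdV dW hdW) S x) = fS x := by
  obtain ⟨a, y⟩ := x
  beta_reduce
  have hcmp : (archPart (Fp L) L (IsCMField.complexConj L) (n + n) (hermD L e dV hdV dW hdW) (placesEmbed L (hermD L e dV hdV dW hdW) S (a, y)), fun v : S => evalPlace (Fp L) L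
      (IsCMField.complexConj L) (n + n) (hermD L e dV hdV dW hdW) v.1 (finPart (Fp L) L (IsCMField.complexConj L) (n + n) (hermD L e dV hdV dW hdW) (placesEmbed L
      (hermD L e dV hdV dW hdW) S (a, y)))) = (a, y) :=
    Prod.ext (archPart_placesEmbed L e dV hdV dW hdW S a y) (funext fun v => evalPlace_finPart_placesEmbed_of_mem L e dV hdV dW hdW S a y v.1 v.2)
  rw [hcmp, finprod_eq_one_of_forall_eq_one, mul_one]
  intro v
  rw [evalPlace_finPart_placesEmbed_of_not_mem L e dV hdV dW hdW S a y v.1 v.2]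
  exact lambdaLoc_one L e dV hdV dW hdW v.1 χ s₀ (hχ v.1 v.2)

set_option maxHeartbeats 400000 in -- the doubled unitary datum's binder telescope
omit [DecidableEq (HeightOneSpectrum (𝓞 (Fp L)))] in
/-- **right `K^S_H`-invariance of `φ`**: `φ(h k) = φ(h)` for `k_∞ = 1`, all `k_v ∈ K_{H,v}`, `k_v = 1` (`v ∈ S`) — the by-value hypothesis `_hR` of ★ #31s.
[cite: Liu2011, §2B p. 862] [cite: Tan1999, §1] -/
theorem restrictedProduct_mul_of_mem_KS (hχ : ∀ v, v ∉ S → ∀ w' : PlacesOver L v, χ.IsUnramifiedAt w'.1) (fS : arch (Fp L) L (IsCMField.complexConj L) (n + n) (hermD L e dV hdV dW hdW) ×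
    (Π v : S, localPi L (IsCMField.complexConj L) (n + n) (hermD L e dV hdV dW hdW) v.1) → ℂ) (h k : HA L e dV hdV dW hdW)
    (hk1 : archPart (Fp L) L (IsCMField.complexConj L) (n + n) (hermD L e dV hdV dW hdW) k = 1) (hk2 : ∀ v, evalPlace (Fp L) L (IsCMField.complexConj L) (n + n)
        (hermD L e dV hdV dW hdW) v (finPart (Fp L) L (IsCMField.complexConj L) (n + n) (hermD L e dV hdV dW hdW) k) ∈ localInt L (IsCMField.complexConj L) (n + n)
        (hermD L e dV hdV dW hdW) v)
    (hk3 : ∀ v ∈ S, evalPlace (Fp L) L (IsCMField.complexConj L) (n + n) (hermD L e dV hdV dW hdW) v (finPart (Fp L) L (IsCMField.complexConj L) (n + n) (hermD L e dV hdV dW hdW) k) = 1) :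
    (fun h : HA L e dV hdV dW hdW => fS (archPart (Fp L) L (IsCMField.complexConj L) (n + n) (hermD L e dV hdV dW hdW) h, fun v : S => evalPlace (Fp L) L (IsCMField.complexConj L) (n + n)
        (hermD L e dV hdV dW hdW) v.1 (finPart (Fp L) L (IsCMField.complexConj L) (n + n) (hermD L e dV hdV dW hdW) h)) * ∏ᶠ v : {v : HeightOneSpectrum (𝓞
        (Fp L)) // v ∉ S}, LambdaLoc L e dV hdV dW hdW v.1 χ s₀ (evalPlace (Fp L) L (IsCMField.complexConj L) (n + n) (hermD L e dV hdV dW hdW) v.1 (finPart (Fp L) L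
        (IsCMField.complexConj L) (n + n) (hermD L e dV hdV dW hdW) h))) (h * k) = (fun h : HA L e dV hdV dW hdW => fS (archPart (Fp L) L (IsCMField.complexConj L) (n + n)
        (hermD L e dV hdV dW hdW) h, fun v : S => evalPlace (Fp L) L (IsCMField.complexConj L) (n + n) (hermD L e dV hdV dW hdW) v.1 (finPart (Fp L) L (IsCMField.complexConj L) (n + n)
        (hermD L e dV hdV dW hdW) h)) * ∏ᶠ v : {v : HeightOneSpectrum (𝓞 (Fp L)) // v ∉ S}, LambdaLoc L e dV hdV dW hdW v.1 χ s₀ (evalPlace (Fp L) L (IsCMField.complexConj L) (n + n)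
        (hermD L e dV hdV dW hdW) v.1 (finPart (Fp L) L (IsCMField.complexConj L) (n + n) (hermD L e dV hdV dW hdW) h))) h := by
  beta_reduce
  have h1 : archPart (Fp L) L (IsCMField.complexConj L) (n + n) (hermD L e dV hdV dW hdW) (h * k) = archPart (Fp L) L (IsCMField.complexConj L) (n + n)
      (hermD L e dV hdV dW hdW) h := by rw [archPart_mul', hk1, mul_one]
  have h2 : (fun v : S => evalPlace (Fp L) L (IsCMField.complexConj L) (n + n) (hermD L e dV hdV dW hdW) v.1 (finPart (Fp L) L (IsCMField.complexConj L) (n + n) (hermD L e dV hdV dW hdW)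
      (h * k))) = fun v : S => evalPlace (Fp L) L (IsCMField.complexConj L) (n + n) (hermD L e dV hdV dW hdW) v.1 (finPart (Fp L) L (IsCMField.complexConj L) (n + n)
      (hermD L e dV hdV dW hdW) h) :=
    funext fun v => by rw [evalPlace_finPart_mul', hk3 v.1 v.2, mul_one]
  rw [h1, h2, finprod_lambdaLoc_mul_of_mem_localInt L e dV hdV dW hdW S χ s₀ hχ h k hk2]

set_option maxHeartbeats 400000 in -- the doubled unitary datum's binder telescope
/-- **THE RESTRICTED PRODUCT OF LOCAL SIEGEL SECTIONS IS A GLOBAL SIEGEL SECTION** (#33b (c)): for `fS` a `δ_{χ,s₀} ∘ placesEmbed`-section on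
`H_∞ × ∏_{v∈S} H(L⁺_v)` (`hfS`), `χ` unramified off `S` (`hχ`) and `δ_{χ,s₀}` trivial on `P_Δ(𝔸) ∩ K^S_H` (`hδK`, organ (c0)),
`φ(h) = fS(h_∞, h_S) · ∏ᶠ_{v∉S} Λ_{s₀,v}(h_v)` is a Siegel section: `φ(p h) = δ_{χ,s₀}(p) φ(h)` for every `p ∈ P_Δ(𝔸)`.
[cite: Tan1999, §1] [cite: Liu2011, §2B–2C pp. 862–863] [cite: GelbartPiatetskishapiroRallis1987, Part A §1] [cite: KudlaRallis1994, §1] -/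
theorem isSiegelDeltaSection_restrictedProduct (hχ : ∀ v, v ∉ S → ∀ w' : PlacesOver L v, χ.IsUnramifiedAt w'.1)
    (hδK : ∀ q : HA L e dV hdV dW hdW, IsSiegelDelta L e dV hdV dW hdW q → archPart (Fp L) L (IsCMField.complexConj L) (n + n) (hermD L e dV hdV dW hdW) q = 1 → (∀ v, evalPlace (Fp L) L
        (IsCMField.complexConj L) (n + n) (hermD L e dV hdV dW hdW) v (finPart (Fp L) L (IsCMField.complexConj L) (n + n) (hermD L e dV hdV dW hdW) q) ∈ localInt L
        (IsCMField.complexConj L) (n + n) (hermD L e dV hdV dW hdW) v) →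
      (∀ v ∈ S, evalPlace (Fp L) L (IsCMField.complexConj L) (n + n) (hermD L e dV hdV dW hdW) v (finPart (Fp L) L (IsCMField.complexConj L) (n + n)
          (hermD L e dV hdV dW hdW) q) = 1) → siegelDeltaCharacter L e dV hdV dW hdW χ s₀ q = 1)
    (fS : arch (Fp L) L (IsCMField.complexConj L) (n + n) (hermD L e dV hdV dW hdW) × (Π v : S, localPi L (IsCMField.complexConj L) (n + n) (hermD L e dV hdV dW hdW) v.1) → ℂ)
    (hfS : ∀ x, IsSiegelDelta L e dV hdV dW hdW (placesEmbed L (hermD L e dV hdV dW hdW) S x) →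
      ∀ y, fS (x * y) = siegelDeltaCharacter L e dV hdV dW hdW χ s₀ (placesEmbed L (hermD L e dV hdV dW hdW) S x) * fS y) :
    IsSiegelDeltaSection L e dV hdV dW hdW χ s₀ (fun h : HA L e dV hdV dW hdW => fS (archPart (Fp L) L (IsCMField.complexConj L) (n + n)
        (hermD L e dV hdV dW hdW) h, fun v : S => evalPlace (Fp L) L (IsCMField.complexConj L) (n + n) (hermD L e dV hdV dW hdW) v.1 (finPart (Fp L) L (IsCMField.complexConj L) (n + n)
        (hermD L e dV hdV dW hdW) h)) * ∏ᶠ v : {v : HeightOneSpectrum (𝓞 (Fp L)) // v ∉ S}, LambdaLoc L e dV hdV dW hdW v.1 χ s₀ (evalPlace (Fp L) L (IsCMField.complexConj L) (n + n)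
        (hermD L e dV hdV dW hdW) v.1 (finPart (Fp L) L (IsCMField.complexConj L) (n + n) (hermD L e dV hdV dW hdW) h))) := by
  intro p hp h
  beta_reduce
  have hcmp : (archPart (Fp L) L (IsCMField.complexConj L) (n + n) (hermD L e dV hdV dW hdW) (p * h), fun v : S => evalPlace (Fp L) L (IsCMField.complexConj L) (n + n)
      (hermD L e dV hdV dW hdW) v.1 (finPart (Fp L) L (IsCMField.complexConj L) (n + n) (hermD L e dV hdV dW hdW) (p * h))) =
      (archPart (Fp L) L (IsCMField.complexConj L) (n + n) (hermD L e dV hdV dW hdW) p, fun v : S => evalPlace (Fp L) L (IsCMField.complexConj L) (n + n) (hermD L e dV hdV dW hdW) v.1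
          (finPart (Fp L) L (IsCMField.complexConj L) (n + n) (hermD L e dV hdV dW hdW) p)) * (archPart (Fp L) L (IsCMField.complexConj L) (n + n)
          (hermD L e dV hdV dW hdW) h, fun v : S => evalPlace (Fp L) L (IsCMField.complexConj L) (n + n) (hermD L e dV hdV dW hdW) v.1 (finPart (Fp L) L (IsCMField.complexConj L) (n + n)
          (hermD L e dV hdV dW hdW) h)) :=
    Prod.ext (archPart_mul' L e dV hdV dW hdW p h) (funext fun v => evalPlace_finPart_mul' L e dV hdV dW hdW v.1 p h)
  rw [hcmp, hfS _ (isSiegelDelta_placesEmbed L e dV hdV dW hdW S p hp), finprod_lambdaLoc_siegel_mul L e dV hdV dW hdW S χ s₀ hχ p h hp,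
    siegelDeltaCharacter_eq_placesEmbed_mul_finprod L e dV hdV dW hdW S χ s₀ hχ hδK p hp]
  ring

end Summit.HodgeConjecture.HodgeConjecture.Cruxes.HLiu418.K2LiuSiegelSectionRestrictedProduct

end
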